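import Literature.NumberTheory.EllipticCurves.VariableChangePointsMap
import Mathlib.Tactic.ComputeDegree
import HarnessLib

/-!
# A Weierstrass automorphism with infinitely many fixed points is the identity

`Proofs` file (theorems only, no definitions, no named facts, no instances) in topic
`NumberTheory/EllipticCurves`, landed by the tenured seat of bsd.S15
(`Literature.NumberTheory.EllipticCurves.conductorNorm_eq_artinConductorNat`) as the elementary
algebraic input of the `ℓ`-independence argument (Silverman *ATAEC* Thm. IV.10.2(c), Serre–Tate
1968 §3) at the potentially good places: the inertia group acts on the reduced curve through
automorphisms (changes of Weierstrass coordinates fixing `O`), and **a non-trivial automorphism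
has only finitely many fixed points**, so an inertia element acting trivially on infinitely many
torsion points acts on the reduction as the identity.

## Main result

* `WeierstrassCurve.VariableChange.eq_one_of_infinite_fixedPoints` — for a Weierstrass equation
  `V` over a field `k` and an admissible change of variables `A = (u, r, s, t)` with `A • V = V`,
  if the induced self-map `P ↦ A(P)` of `V(k)` (`pointEquiv` followed by the transport along
  `A • V = V`) fixes infinitely many points, then `A = 1`.

Proof (elementary, valid in every characteristic and for singular `V` as well): a fixed affine
point `(x, y)` satisfies `(u⁻² - 1)x = -u⁻²r` and `(u⁻³ - 1)y = -u⁻³(s(x - r) + t)`; so either the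
`x`-coordinate of a fixed point is pinned down to one value (`u⁻² ≠ 1`, or `u⁻² = 1`, `r = 0`,
`u⁻³ = 1`, `s ≠ 0`), or there are no affine fixed points (`u⁻² = 1`, `r ≠ 0`; or `u = 1`,
`r = s = 0`, `t ≠ 0`), or the fixed points lie on a line `y = αx + β`, which meets the cubic
`V` in at most three abscissae (`u⁻² = 1`, `r = 0`, `u⁻³ ≠ 1`), or finally `A = 1`; and over
each abscissa `x` there are at most two points of `V(k)` (roots of the monic quadratic in `y`).
(Silverman, *AEC*, III.10: the automorphism group of an elliptic curve is finite and acts with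
finitely many fixed points; here only the finiteness of fixed points is needed, in coordinates.)

## References

* [SilvermanAEC2009] J. H. Silverman, *The Arithmetic of Elliptic Curves*, 2nd ed., III.1
  (changes of variables, Table 3.1), III.10 (automorphisms).
* [SerreTate1968] J.-P. Serre, J. Tate, *Good reduction of abelian varieties*, Ann. of Math. 88
  (1968), §3 (the use made of it: potential good reduction and `ℓ`-independence).

## Design

Pure theorems in `namespace WeierstrassCurve.VariableChange`; `Set.Finite.preimage'` over the
`x`-coordinate map, `Polynomial.finite_setOf_isRoot`, and the `monicity` tactic for the line–cubic
intersection.  Axioms: `propext`, `Classical.choice`, `Quot.sound`.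
-/

noncomputable section

open scoped Classical Polynomial
open Polynomial

namespace WeierstrassCurve

namespace VariableChange

variable {k : Type*} [Field k] (V : WeierstrassCurve k)

/-- Over each abscissa there are finitely many points of `V(k)`: `y` is a root of the monic
quadratic `Y² + (a₁x + a₃)Y - (x³ + a₂x² + a₄x + a₆)`. [folklore] -/
theorem finite_setOf_point_x_eq (x : k) :
    {P : V.toAffine.Point | ∃ (y : k) (h : V.toAffine.Nonsingular x y), P = .some x y h}.Finite := by
  set q : k[X] := X ^ 2 + C (V.a₁ * x + V.a₃) * X - C (x ^ 3 + V.a₂ * x ^ 2 + V.a₄ * x + V.a₆)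
    with hq
  have hqm : q.Monic := by
    rw [hq]
    monicity
    all_goals simp
  have hfin : {y : k | q.IsRoot y}.Finite := Polynomial.finite_setOf_isRoot hqm.ne_zero
  have hroot : ∀ {y : k}, V.toAffine.Nonsingular x y → q.IsRoot y := by
    intro y h
    have he := (V.toAffine.equation_iff x y).mp h.1
    simp only [IsRoot.def, hq, eval_sub, eval_add, eval_pow, eval_X, eval_mul, eval_C]
    linear_combination he
  refine (hfin.image fun y ↦ if h : V.toAffine.Nonsingular x y then
    (Affine.Point.some x y h : V.toAffine.Point) else 0).subset ?_
  rintro P ⟨y, h, rfl⟩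
  exact ⟨y, hroot h, by simp [h]⟩

/-- The set of points of `V(k)` whose abscissa lies in a finite set (together with `O`) is finite.
[folklore] -/
theorem finite_setOf_point_x_mem {S : Set k} (hS : S.Finite) :
    {P : V.toAffine.Point | P = 0 ∨ ∃ (x : k) (y : k) (h : V.toAffine.Nonsingular x y),
      x ∈ S ∧ P = .some x y h}.Finite := by
  have h1 : {P : V.toAffine.Point | ∃ (x : k) (y : k) (h : V.toAffine.Nonsingular x y),
      x ∈ S ∧ P = .some x y h} ⊆
      ⋃ x ∈ S, {P : V.toAffine.Point | ∃ (y : k) (h : V.toAffine.Nonsingular x y),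
        P = .some x y h} := by
    rintro P ⟨x, y, h, hx, rfl⟩
    exact Set.mem_biUnion hx ⟨y, h, rfl⟩
  have h2 : (⋃ x ∈ S, {P : V.toAffine.Point | ∃ (y : k) (h : V.toAffine.Nonsingular x y),
      P = .some x y h}).Finite := hS.biUnion fun x _ ↦ finite_setOf_point_x_eq V x
  refine ((Set.finite_singleton (0 : V.toAffine.Point)).union (h2.subset h1)).subset ?_
  rintro P (rfl | hP)
  · exact Or.inl rfl
  · exact Or.inr hP

/-- Points of `V(k)` on a line `y = αx + β` have finitely many abscissae: the cubic
`X³ + a₂X² + a₄X + a₆ - ((αX + β)² + a₁X(αX + β) + a₃(αX + β))` is monic, hence non-zero.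
[folklore] -/
theorem finite_setOf_x_line (α β : k) :
    {x : k | ∃ y : k, V.toAffine.Nonsingular x y ∧ y = α * x + β}.Finite := by
  set q : k[X] := X ^ 3 + C V.a₂ * X ^ 2 + C V.a₄ * X + C V.a₆ -
    ((C α * X + C β) ^ 2 + C V.a₁ * X * (C α * X + C β) + C V.a₃ * (C α * X + C β)) with hq
  have hqm : q.Monic := by
    rw [hq]
    monicity
    all_goals simp
  have hfin : {x : k | q.IsRoot x}.Finite := Polynomial.finite_setOf_isRoot hqm.ne_zero
  refine hfin.subset ?_
  rintro x ⟨y, h, rfl⟩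
  have he := (V.toAffine.equation_iff x (α * x + β)).mp h.1
  simp only [Set.mem_setOf_eq, IsRoot.def, hq, eval_sub, eval_add, eval_pow, eval_X, eval_mul,
    eval_C]
  linear_combination -he

variable {V}

/-- **A change of Weierstrass coordinates `A` with `A • V = V` whose induced self-map of `V(k)`
has infinitely many fixed points is the identity.**  See the module docstring for the case
analysis. (Silverman, *AEC*, III.10: automorphisms; here in the form needed for the Serre–Tate
`ℓ`-independence argument, *ATAEC* IV.10.2(c).)
[cite: SilvermanAEC2009, III.1 Table 3.1 and III.10] -/
theorem eq_one_of_infinite_fixedPoints {A : VariableChange k} (hA : A • V = V)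
    (hinf : {P : V.toAffine.Point |
      Affine.Point.congrEquiv hA (pointEquiv V A P) = P}.Infinite) : A = 1 := by
  by_contra hA1
  apply hinf
  -- notation
  set μ : k := ((A.u⁻¹ : kˣ) : k) with hμ
  have hμ0 : μ ≠ 0 := Units.ne_zero _
  -- a fixed affine point satisfies the two coordinate equations
  have hfix : ∀ {x y : k} (h : V.toAffine.Nonsingular x y),
      Affine.Point.congrEquiv hA (pointEquiv V A (.some x y h)) = .some x y h →
        μ ^ 2 * (x - A.r) = x ∧ μ ^ 3 * (y - A.s * (x - A.r) - A.t) = y := by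
    intro x y h hP
    rw [pointEquiv_some, Affine.Point.congrEquiv_some, Affine.Point.some.injEq] at hP
    exact ⟨hP.1, hP.2⟩
  -- Strategy: exhibit a finite set `S` of abscissae containing those of all fixed affine points.
  suffices hS : ∃ S : Set k, S.Finite ∧ ∀ {x y : k} (h : V.toAffine.Nonsingular x y),
      Affine.Point.congrEquiv hA (pointEquiv V A (.some x y h)) = .some x y h → x ∈ S by
    obtain ⟨S, hSfin, hSx⟩ := hS
    refine (finite_setOf_point_x_mem V hSfin).subset ?_
    intro P hP
    rcases P with _ | ⟨x, y, h⟩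
    · exact Or.inl rfl
    · exact Or.inr ⟨x, y, h, hSx h hP, rfl⟩
  by_cases h2 : μ ^ 2 = 1
  · -- `μ² = 1`: then `r = 0` is forced by any fixed affine point
    by_cases hr : A.r = 0
    · by_cases h3 : μ ^ 3 = 1
      · -- `μ² = μ³ = 1`, so `μ = 1`, `u = 1`
        have hμ1 : μ = 1 := by
          have : μ ^ 3 = μ ^ 2 * μ := by ring
          rw [this, h2, one_mul] at h3
          exact h3
        by_cases hs : A.s = 0
        · by_cases ht : A.t = 0
          · -- then `A = 1`
            exfalso
            apply hA1
            have hu : A.u = 1 := by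
              have : (A.u⁻¹ : kˣ) = 1 := Units.ext (by rw [← hμ, hμ1, Units.val_one])
              simpa using this
            cases A
            simp only [VariableChange.one_def, VariableChange.mk.injEq]
            exact ⟨hu, hr, hs, ht⟩
          · -- `t ≠ 0`: no affine fixed point
            refine ⟨∅, Set.finite_empty, fun {x y} h hP ↦ ?_⟩
            obtain ⟨-, hy⟩ := hfix h hP
            rw [hr, hs, hμ1] at hy
            exact absurd (by linear_combination -hy) ht
        · -- `s ≠ 0`: the abscissa is `-t/s`
          refine ⟨{-A.t / A.s}, Set.finite_singleton _, fun {x y} h hP ↦ ?_⟩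
          obtain ⟨-, hy⟩ := hfix h hP
          rw [hr, hμ1] at hy
          rw [Set.mem_singleton_iff, eq_div_iff hs]
          linear_combination -hy
      · -- `μ³ ≠ 1`: the fixed points lie on the line `y = α x + β`
        set α : k := -(μ ^ 3 * A.s) / (1 - μ ^ 3) with hα
        set β : k := -(μ ^ 3 * A.t) / (1 - μ ^ 3) with hβ
        have h13 : (1 - μ ^ 3) ≠ 0 := sub_ne_zero.mpr (Ne.symm h3)
        refine ⟨{x : k | ∃ y : k, V.toAffine.Nonsingular x y ∧ y = α * x + β},
          finite_setOf_x_line V α β, fun {x y} h hP ↦ ⟨y, h, ?_⟩⟩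
        obtain ⟨-, hy⟩ := hfix h hP
        rw [hr, sub_zero] at hy
        rw [hα, hβ, div_mul_eq_mul_div, ← add_div, eq_div_iff h13]
        linear_combination -hy
    · -- `r ≠ 0`: no affine fixed point
      refine ⟨∅, Set.finite_empty, fun {x y} h hP ↦ ?_⟩
      obtain ⟨hx, -⟩ := hfix h hP
      rw [h2, one_mul, sub_eq_self] at hx
      exact absurd hx hr
  · -- `μ² ≠ 1`: the abscissa is pinned down
    have h12 : μ ^ 2 - 1 ≠ 0 := sub_ne_zero.mpr h2
    refine ⟨{μ ^ 2 * A.r / (μ ^ 2 - 1)}, Set.finite_singleton _, fun {x y} h hP ↦ ?_⟩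
    obtain ⟨hx, -⟩ := hfix h hP
    rw [Set.mem_singleton_iff, eq_div_iff h12]
    linear_combination hx

end VariableChange

end WeierstrassCurve

end
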